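import Literature.NumberTheory.EllipticCurves.KugaSatoVarietyAutomorphisms
import HarnessLib

/-!
# Inversions conjugate translations into inverse translations (commutative case)

Topic: `Literature/NumberTheory/EllipticCurves`. Complement to `KugaSatoVarietyAutomorphisms.lean`,
which derives the relations among the automorphisms `translW i (a, b)`, `negW i`, `permW σ` of a
`KugaSatoVariety K m N` (Deninger–Scholl 5.3 (i): the translations by `N`-torsion sections
`(ℤ/N)^{2m}`, the inversions `μ₂^m` and the permutations `S_m` "generate a group `Γ` of
automorphisms") from relations on the dense open `E^m ↪ W`. The one relation missing there is the
action of the inversions on the translations, which presents `Γ` as an iterated semidirect product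
`(ℤ/N)^{2m} ⋊ (μ₂^m ⋊ S_m)`:

* `KugaSato.neg_transl_neg` — on `E^m`, for a COMMUTATIVE `S`-group scheme `E`
  (Mathlib `IsCommMonObj`): `neg i ≫ transl i s ≫ neg i = transl i s⁻¹`
  (`x ↦ ((x⁻¹) s)⁻¹ = s⁻¹ x = x s⁻¹`; without commutativity the left-hand side is the LEFT
  translation by `s⁻¹`, which is not among the generators);
* `LevelStructure.section_neg` — `φ(-u) = φ(u)⁻¹` for commuting `P, Q`;
* `KugaSatoVariety.negW_translW_negW` — on `W`: `negW i ≫ translW i u ≫ negW i = translW i (-u)`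
  for a Kuga–Sato variety whose universal curve is a commutative group scheme (automatic for an
  elliptic curve, Katz–Mazur Thm. 2.1.2 "commutative group scheme", but not recorded by
  `EllCurveOver`; see the design notes of `KugaSatoVariety.lean`), by uniqueness of extensions
  (`KugaSatoVariety.iso_eq_of_extends`);
* small complements: `translW_zero` (`translW i 0 = 𝟙`), `translW_neg_trans` / `translW_trans_neg`
  (`translW i (-u)` is inverse to `translW i u`).

No named facts.

## References

* C. Deninger, A. J. Scholl, *The Beilinson conjectures*, in *L-functions and Arithmetic*,
  LMS LNS 153 (1991), 5.3 (i). [DeningerScholl1991]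
* N. Katz, B. Mazur, *Arithmetic moduli of elliptic curves* (1985), Thm. 2.1.2. [KatzMazur1985]
-/

universe u

open CategoryTheory Limits AlgebraicGeometry MonoidalCategory CartesianMonoidalCategory
open scoped MonObj

noncomputable section

namespace Literature.NumberTheory.EllipticCurves

/-! ### On the fibre power `E^m` -/

namespace KugaSato

variable {S : Scheme.{u}} (E : Over S) (m : ℕ) [GrpObj E]

/-- For any `S`-group scheme `E`: conjugating the right translation `x ↦ x s` on the `i`-th factor
by the inversion gives `x ↦ (x⁻¹ s)⁻¹ = s⁻¹ x`, i.e. `onFactor i` of the LEFT translation by `s⁻¹`.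
[folklore] -/
theorem neg_transl_neg_eq_onFactor (i : Fin m) (s : 𝟙_ (Over S) ⟶ E) :
    neg E m i ≫ transl E m i s ≫ neg E m i = onFactor E m i ((toUnit E ≫ s)⁻¹ * 𝟙 E) := by
  rw [neg, transl, onFactor_comp, onFactor_comp]
  congr 1
  rw [GrpObj.inv_eq_inv, GrpObj.comp_inv (𝟙 E * (toUnit E ≫ s)) (𝟙 E), Category.comp_id,
    GrpObj.comp_inv, MonObj.comp_mul, Category.comp_id, comp_toUnit_assoc, mul_inv_rev, inv_inv]

/-- **Inversions conjugate translations into inverse translations** on `E^m`, for a commutative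
`S`-group scheme `E`: `neg i ≫ transl i s ≫ neg i = transl i s⁻¹` (`x ↦ (x⁻¹ s)⁻¹ = x s⁻¹`). This is
the relation making the group generated by the translations by sections and the inversions in the
factors a semidirect product (Deninger–Scholl 5.3 (i)). [cite: DeningerScholl1991, 5.3 (i)] -/
theorem neg_transl_neg [IsCommMonObj E] (i : Fin m) (s : 𝟙_ (Over S) ⟶ E) :
    neg E m i ≫ transl E m i s ≫ neg E m i = transl E m i s⁻¹ := by
  rw [neg_transl_neg_eq_onFactor, transl, GrpObj.comp_inv, mul_comm]

end KugaSato

/-! ### On level structures -/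

namespace EllCurveOver.LevelStructure

variable {S : Scheme.{u}} {C : EllCurveOver S} {N : ℕ} (φ : LevelStructure N C)

/-- For commuting `P, Q`: `φ(-u) = φ(u)⁻¹` (additivity of `u ↦ φ(u) = P^a Q^b`,
`LevelStructure.section_add`). [folklore] -/
theorem section_neg [NeZero N] (hc : Commute φ.P φ.Q) (u : ZMod N × ZMod N) :
    φ.section_ (-u) = (φ.section_ u)⁻¹ :=
  eq_inv_of_mul_eq_one_left (by rw [← φ.section_add hc, neg_add_cancel, section_zero])

end EllCurveOver.LevelStructure

/-! ### On `W` -/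

namespace KugaSatoVariety

variable {K : Type u} [Field K] {m N : ℕ} (V : KugaSatoVariety K m N)

/-- **Translation by `φ(0, 0) = 0` is the identity of `W`.** [folklore] -/
theorem translW_zero (i : Fin m) : V.translW i 0 = Iso.refl V.W :=
  V.iso_eq_of_extends (V.translW_extends i 0) V.refl_extends
    (by rw [EllCurveOver.LevelStructure.section_zero, KugaSato.transl_one])

/-- `translW i (-u)` followed by `translW i u` is the identity (commuting `P, Q`). [folklore] -/
theorem translW_neg_trans [NeZero N] (hc : Commute V.level.P V.level.Q) (i : Fin m)
    (u : ZMod N × ZMod N) : V.translW i (-u) ≪≫ V.translW i u = Iso.refl V.W := by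
  rw [V.translW_translW hc, neg_add_cancel, V.translW_zero]

/-- `translW i u` followed by `translW i (-u)` is the identity (commuting `P, Q`). [folklore] -/
theorem translW_trans_neg [NeZero N] (hc : Commute V.level.P V.level.Q) (i : Fin m)
    (u : ZMod N × ZMod N) : V.translW i u ≪≫ V.translW i (-u) = Iso.refl V.W := by
  rw [V.translW_translW hc, add_neg_cancel, V.translW_zero]

/-- `translW i (-u)` is the inverse isomorphism of `translW i u` (commuting `P, Q`). [folklore] -/
theorem translW_neg [NeZero N] (hc : Commute V.level.P V.level.Q) (i : Fin m)
    (u : ZMod N × ZMod N) : V.translW i (-u) = (V.translW i u).symm :=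
  Iso.ext (((V.translW i u).comp_hom_eq_id).mp (by
    rw [← Iso.trans_hom, V.translW_neg_trans hc, Iso.refl_hom]))

/-- **Inversions conjugate translations into inverse translations on `W`**:
`negW i ≫ translW i u ≫ negW i = translW i (-u)`, for a Kuga–Sato variety whose universal curve is a
commutative group scheme (automatic for elliptic curves, Katz–Mazur Thm. 2.1.2, not recorded by
`EllCurveOver`). With `KugaSatoVarietyAutomorphisms` this completes the presentation of the group
`Γ` of Deninger–Scholl 5.3 (i) generated by `translW`, `negW`, `permW` as a quotient of
`(ℤ/N)^{2m} ⋊ (μ₂^m ⋊ S_m)`. [cite: DeningerScholl1991, 5.3 (i)] -/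
theorem negW_translW_negW [NeZero N] [IsCommMonObj V.curve.E] (i : Fin m)
    (u : ZMod N × ZMod N) : V.negW i ≪≫ V.translW i u ≪≫ V.negW i = V.translW i (-u) :=
  V.iso_eq_of_extends
    (V.trans_extends (V.negW_extends i) (V.trans_extends (V.translW_extends i u) (V.negW_extends i)))
    (V.translW_extends i (-u))
    (by rw [KugaSato.neg_transl_neg, V.level.section_neg (Commute.all _ _)])

end KugaSatoVariety

end Literature.NumberTheory.EllipticCurves

end
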